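import Literature.Computability.QuantumComplexity.PseudoGaussianSamplerMachine
import Literature.Computability.Cryptography.CoinChunks
import HarnessLib

/-!
# The perturbation vector of Peikert's reduction is polynomial time (typed `FP` on codes)

Topic `Computability/Cryptography` (family `pqc`), machine side of the first component of Peikert's
`GapSVP → LWE` reduction (`PeikertReduction.lean`, hypothesis `h₁` of
`peikert_gapSVPZeta_to_lwe_classical_of_components`, named fact
`Literature.Computability.Cryptography.peikert_gapSVPZeta_to_lwe_classical`, pqc.S20): the perturbation
`w ∈ ℤⁿ` of an iteration is manufactured coordinate by coordinate by the coin-driven pseudo-Gaussian sampler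
(`Probability/Distributions/PseudoGaussianSampler*.lean`; typed polynomial time as
`Literature.Computability.QuantumComplexity.samplerOf_codeFP` on `⟨record, coin block⟩`), reading `n`
consecutive chunks of width `coinLen` of a coin block. This file assembles that vector program in the
typed algebra `CodeFP` (no machine is written):

* `samplerVecOf c n cl w = [samplerOf c w[0,cl), …, samplerOf c w[(n-1)cl, n·cl)]` — the vector against the
  sampler's parameter record `c`, the dimension `n`, the chunk width `cl` and the coin block `w`;
* **`samplerVecOf_codeFP`** — `⟨c, ⟨1ⁿ, ⟨1^{cl}, w⟩⟩⟩ ↦ samplerVecOf c n cl w` is typed polynomial time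
  (`strChunks` then `CodeFP.map` of `samplerOf` with the record as context);
* `samplerVecOf_ctx` — at the record `P.ctx` and width `P.coinLen` it is the vector of flat samplers on
  the chunks, `fun i => P.samplerFlat (chunk P.coinLen w i)` (`samplerOf_ctx`), i.e. the perturbation
  whose law under uniform coins is the product law `⨂ⁿ ℓ'` (`Cryptography/CoinBlockLaws.lean`).

## References

* C. Peikert, *Public-key cryptosystems from the worst-case shortest vector problem*, STOC 2009, proof of
  Thm. 3.1, step 1 (sample the perturbation) [Peikert2009].
* S. Arora, B. Barak, *Computational Complexity: A Modern Approach*, CUP 2009, §1.3 (closure of polynomial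
  time under composition and polynomially bounded loops) [AroraBarak2009].
-/

namespace Literature.Computability.Cryptography

open Literature.Computability.Complexity Literature.Computability.Complexity.CodeFP
  Literature.Computability.QuantumComplexity Literature.Probability.Distributions

/-! ### The vector program -/

/-- **The perturbation vector against the record**: the sampler `samplerOf c` applied to the `n`
consecutive chunks of width `cl` of the coin block `w`. [cite: Peikert2009, Thm. 3.1 proof (step 1)] -/
def samplerVecOf (c : SamplerCtx) (n cl : ℕ) (w : List Bool) : List ℤ :=
  (List.range n).map fun i => samplerOf c ((w.drop (i * cl)).take cl)

/-- `samplerVecOf` has `n` coordinates. [folklore] -/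
theorem length_samplerVecOf (c : SamplerCtx) (n cl : ℕ) (w : List Bool) : (samplerVecOf c n cl w).length = n := by
  simp [samplerVecOf]

/-- **At the record of `P` (width `coinLen`) the coordinates are the flat samplers on the chunks of the
block**: `samplerVecOf P.ctx n P.coinLen w = [P.samplerFlat (chunk coinLen w 0), …]`. [folklore] -/
theorem samplerVecOf_ctx (P : PGParams) (n : ℕ) (w : List Bool) :
    samplerVecOf P.ctx n P.coinLen w = (List.range n).map fun i => P.samplerFlat (chunk P.coinLen w i) := by
  unfold samplerVecOf
  refine List.map_congr_left fun i _ => ?_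
  rw [samplerOf_ctx, chunk, mul_comm]

/-- The `i`-th coordinate at the record of `P`. [folklore] -/
theorem getElem_samplerVecOf_ctx (P : PGParams) (n : ℕ) (w : List Bool) {i : ℕ}
    (hi : i < (samplerVecOf P.ctx n P.coinLen w).length) :
    (samplerVecOf P.ctx n P.coinLen w)[i] = P.samplerFlat (chunk P.coinLen w i) := by
  simp [samplerVecOf_ctx]

/-! ### Typed polynomial time -/

/-- The argument code `⟨record, ⟨1ⁿ, ⟨1^{cl}, block⟩⟩⟩`. [folklore] -/
abbrev samplerVecArgE : SamplerCtx × (ℕ × (ℕ × List Bool)) → List Bool :=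
  pairE samplerCtxE (pairE unE (pairE unE strE))

/-- **The perturbation vector is typed polynomial time**:
`⟨c, ⟨1ⁿ, ⟨1^{cl}, w⟩⟩⟩ ↦ samplerVecOf c n cl w` (cut the block into `n` chunks of width `cl`, `strChunks`;
map the sampler over them with the record as context, `CodeFP.map` with `samplerOf_codeFP`).
[cite: AroraBarak2009, §1.3] -/
theorem samplerVecOf_codeFP :
    CodeFP samplerVecArgE (rawE intE) (fun p => samplerVecOf p.1 p.2.1 p.2.2.1 p.2.2.2) := by
  -- the chunks `(1ⁿ, 1^{cl}, w) ↦ [w[0,cl), …]`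
  have hchunks : CodeFP samplerVecArgE (rawE strE)
      (fun p => (List.range p.2.1).map fun i => (p.2.2.2.drop (i * p.2.2.1)).take p.2.2.1) := by
    exact (strChunks.comp (snd _ _) :)
  -- map the sampler with the record as context
  have hmap : CodeFP samplerVecArgE (rawE intE)
      (fun p => ((List.range p.2.1).map fun i => (p.2.2.2.drop (i * p.2.2.1)).take p.2.2.1).map
        fun blk => samplerOf p.1 blk) := by
    exact ((map (σ := SamplerCtx) (α := List Bool) (g := fun q => samplerOf q.1 q.2) samplerOf_codeFP).comp
      ((fst _ _).pair hchunks) :)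
  refine hmap.congr fun p => ?_
  simp only [samplerVecOf, List.map_map]
  rfl

end Literature.Computability.Cryptography
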